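import Summits.MatrixMultiplication.MatrixMultiplication.Theses.NonabelianARC
import Summits.MatrixMultiplication.MatrixMultiplication.Theorems.AsymptoticRankCWGlueDet3Omega
import Summits.MatrixMultiplication.MatrixMultiplication.Theorems.AsymptoticRankCWBPerm3Form
import Literature.Computability.AlgebraicComplexity.ThreeJTensor
import HarnessLib

/-!
# `NAARCLadder` from `Det3Flat` and the higher rungs (route `MatrixMultiplication/NonabelianARC`,
crux-strategist decomposition of the deciding crux `stmt-MatrixMultiplication-4972`)

The deciding crux `NAARCLadder` of route NonabelianARC is `X_MaMu ∧ X_J`: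
`(∀ n ≥ 1, R̃(⟨n,n,n⟩) = n²) ∧ (∀ l ≥ 1, R̃(J_l) = 2l+1)`, and `X_MaMu ↔ ω(ℂ) = 2` is in the tree
(`asymptoticRank_matMulTensor`), so as ONE item it restates the summit. This file proves the typed
decomposition recorded on the route (rev 2) as the glue item `NAARCLadderOfRungs`
(`stmt-MatrixMultiplication-17871`; new crux `JLadderHigherFlat` = `stmt-MatrixMultiplication-17870`):

  `Det3Flat → JLadderHigherFlat → NAARCLadder`,

where
* `Det3Flat := R̃(ε₃ ⊠ ε₃) = 9` (item `stmt-MatrixMultiplication-0591`, the route's rank-3 crux,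
  SHARED verbatim with route AsymptoticRankCW as `BDet3AsymptoticRank`): the `l = 1` rung of the
  ladder in its `det₃` form — `J_1 = -ε₃` (`threeJTensor_one`) and `R̃(ε₃ ⊠ ε₃) = R̃(ε₃)²`; an
  instance of Strassen's asymptotic rank conjecture for ONE explicit tight tensor
  (`ε₃ ≅ T_skewcw,2`, `ε₃ ⊠ ε₃ ≅ det₃`, Conner–Gesmundo–Landsberg–Ventura 2022 §2.2–2.3), open;
* `JLadderHigherFlat := ∀ l ≥ 2, R̃(J_l) = 2l+1` — the ω-independent rungs of the `SL₂` `3j`-ladder.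

The seam is NOT a bare `And.intro`: the matrix-multiplication conjunct `X_MaMu` is DERIVED from
`Det3Flat` by the PROVED glue `glueDet3Omega_proof : BDet3AsymptoticRank → MatrixMultiplication`
(the skew Coppersmith–Winograd laser bound, CGLV 2022 §2.3: "`R̃(det₃) = 9` would imply `ω = 2`")
followed by `R̃(⟨n,n,n⟩) = n^ω = n²`; the rung `l = 1` of `X_J` is `R̃(J_1) = R̃(ε₃) = R̃(ε₃ ⊠ ε₃)^{1/2}
= 3` (`asymptoticRank_threeJTensor_one`, `asymptoticRank_kroneckerTensor_self`). This is the Wiles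
shape `S ⇐ T ∧ (T ⇒ S)` with `T = Det3Flat` open and `T ⇒ S` proved non-trivially in the tree.

References: A. Conner, F. Gesmundo, J. M. Landsberg, E. Ventura, comput. complexity 31 (2022) =
arXiv:1909.04785, §2.2–2.3, Lemma 2.4; M. Christandl, P. Vrana, J. Zuiddam, J. AMS 36 (2023), §1.1.
-/

-- the Theorems namespace `Summit.MatrixMultiplication.MatrixMultiplication.Theorems` repeats the
-- summit name by design (single-problem summit, D-0017), which trips `linter.dupNamespace`
set_option linter.dupNamespace false

noncomputable section

open scoped BigOperators
open Filter Asymptotics Literature.Computability.AlgebraicComplexity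
open Literature.Barriers.MatrixMultiplication (asymptoticRank_kroneckerPow_le)

namespace Summit.MatrixMultiplication.MatrixMultiplication.Theorems

/-! ## Kronecker squares on `ℂ³ ⊗ ℂ³ ⊗ ℂ³` -/

section Square

/-- **`R̃(t ⊠ t) = R̃(t)²`** for a tensor `t ∈ ℂ³ ⊗ ℂ³ ⊗ ℂ³`: the Kronecker product `t ⊠ t` on
`(Fin 3 × Fin 3)³` is the reindexed tensor power `t^{⊗2}` (a restriction in both directions,
`restrictsTo_squareReindex`), and `R̃(t^{⊗2}) = R̃(t)²` (Christandl–Vrana–Zuiddam 2023 §1.1: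
`asymptoticRank_kroneckerPow_le`, `pow_asymptoticRank_le_asymptoticRank_kroneckerPow`).
[cite: ChristandlVranaZuiddam2023, §1.1] -/
theorem asymptoticRank_kroneckerTensor_self (t : Fin 3 → Fin 3 → Fin 3 → ℂ) :
    asymptoticRank (kroneckerTensor t t) = asymptoticRank t ^ 2 := by
  have e : squareReindex (kroneckerPow t 2) = kroneckerTensor t t := by
    funext a b c
    rw [squareReindex_kroneckerPow_two, kroneckerTensor_apply]
  have h1 : asymptoticRank (kroneckerTensor t t) = asymptoticRank (kroneckerPow t 2) := by
    rw [← e]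
    exact asymptoticRank_eq_of_restrictsTo (restrictsTo_squareReindex _).1
      (restrictsTo_squareReindex _).2
  rw [h1]
  exact le_antisymm (asymptoticRank_kroneckerPow_le _ (by norm_num))
    (pow_asymptoticRank_le_asymptoticRank_kroneckerPow _ (by norm_num))

end Square

/-! ## The Levi-Civita tensor of the route and `J_1` -/

section LeviCivita

/-- The route's inline Levi-Civita tensor is `ε_{abc}` (`leviCivita3` of `BorderRankCW`), all
`27` entries. [folklore] -/
theorem leviCivitaInline_eq_leviCivita3 (a b c : Fin 3) :
    ((if b = a + 1 ∧ c = a + 2 then (1 : ℂ) else 0) - (if b = a + 2 ∧ c = a + 1 then 1 else 0)) =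
      (leviCivita3 a b c : ℂ) := by
  rw [leviCivita3_eq_table]
  fin_cases a <;> fin_cases b <;> fin_cases c <;> simp [leviCivita3Table]

/-- `ε₃ = (-1) · J_1` pointwise (`threeJTensor_one`: `J_1 = -ε₃`). [folklore] -/
theorem leviCivitaInline_eq_neg_threeJTensor_one :
    (fun a b c : Fin 3 => (if b = a + 1 ∧ c = a + 2 then (1 : ℂ) else 0) -
        (if b = a + 2 ∧ c = a + 1 then 1 else 0)) =
      fun a b c : Fin 3 => (-1 : ℂ) * threeJTensor 1 a b c := by
  funext a b c
  rw [leviCivitaInline_eq_leviCivita3, threeJTensor_one]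
  ring

/-- `R̃(J_1) = R̃(ε₃)`: the two tensors differ by the sign of one leg, a restriction in both
directions. [folklore] -/
theorem asymptoticRank_threeJTensor_one :
    asymptoticRank (threeJTensor 1) =
      asymptoticRank (fun a b c : Fin 3 => (if b = a + 1 ∧ c = a + 2 then (1 : ℂ) else 0) -
        (if b = a + 2 ∧ c = a + 1 then 1 else 0)) := by
  rw [leviCivitaInline_eq_neg_threeJTensor_one]
  exact asymptoticRank_eq_of_restrictsTo
    (tensorRestrictsTo_of_const_mul (threeJTensor 1) (by norm_num : (-1 : ℂ) ≠ 0))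
    (tensorRestrictsTo_const_mul (threeJTensor 1) (-1))

/-- **`R̃(ε₃ ⊠ ε₃) = 9 ⇒ R̃(ε₃) = 3`** (`Det3Flat` gives the `l = 1` rung of the ladder up to the
sign `J_1 = -ε₃`): square root of `asymptoticRank_kroneckerTensor_self`.
[cite: ConnerGesmundoLandsbergVentura2022, §2.3] -/
theorem asymptoticRank_leviCivita_eq_three_of_det3
    (h : asymptoticRank (kroneckerTensor
      (fun a b c : Fin 3 => (if b = a + 1 ∧ c = a + 2 then (1 : ℂ) else 0) -
        (if b = a + 2 ∧ c = a + 1 then 1 else 0))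
      (fun a b c : Fin 3 => (if b = a + 1 ∧ c = a + 2 then (1 : ℂ) else 0) -
        (if b = a + 2 ∧ c = a + 1 then 1 else 0))) = 9) :
    asymptoticRank (fun a b c : Fin 3 => (if b = a + 1 ∧ c = a + 2 then (1 : ℂ) else 0) -
        (if b = a + 2 ∧ c = a + 1 then 1 else 0)) = 3 := by
  rw [asymptoticRank_kroneckerTensor_self] at h
  have h9 : asymptoticRank (fun a b c : Fin 3 => (if b = a + 1 ∧ c = a + 2 then (1 : ℂ) else 0) -
      (if b = a + 2 ∧ c = a + 1 then 1 else 0)) ^ 2 = 3 ^ 2 := by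
    rw [h]; norm_num
  exact (pow_left_inj₀ (asymptoticRank_nonneg _) (by norm_num) two_ne_zero).1 h9

end LeviCivita

/-! ## The decomposition theorem -/

section Split

/-- **`NAARCLadder` from its pieces** (crux-strategist split of `stmt-MatrixMultiplication-4972`,
the route's glue item `NAARCLadderOfRungs`): `Det3Flat → JLadderHigherFlat → NAARCLadder`, the
hypotheses written verbatim as the two piece statements. `X_MaMu` (`R̃(⟨n,n,n⟩) = n²` for all
`n ≥ 1`) follows from `Det3Flat` through `ω(ℂ) = 2` (`glueDet3Omega_proof`, the skew
Coppersmith–Winograd laser bound, proved in tree) and `R̃(⟨n,n,n⟩) = n^ω`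
(`asymptoticRank_matMulTensor`); the rung `l = 1` of `X_J` is `R̃(J_1) = R̃(ε₃) = 3`
(`asymptoticRank_threeJTensor_one`, `asymptoticRank_leviCivita_eq_three_of_det3`); the rungs
`l ≥ 2` are the second hypothesis. [cite: ConnerGesmundoLandsbergVentura2022, §2.2–2.3] -/
theorem NAARCLadder_of_subs
    (h₁ : Literature.Computability.AlgebraicComplexity.asymptoticRank (Literature.Computability.AlgebraicComplexity.kroneckerTensor (fun a b c : Fin 3 => (if b = a + 1 ∧ c = a + 2 then (1 : ℂ) else 0) - (if b = a + 2 ∧ c = a + 1 then 1 else 0)) (fun a b c : Fin 3 => (if b = a + 1 ∧ c = a + 2 then (1 : ℂ) else 0) - (if b = a + 2 ∧ c = a + 1 then 1 else 0))) = 9)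
    (h₂ : let J : (l : ℕ) → Fin (2 * l + 1) → Fin (2 * l + 1) → Fin (2 * l + 1) → ℂ := fun l a b c => if a.val + b.val + c.val = 3 * l then ∑ t ∈ Finset.range (l + 1), (if l ≤ t + b.val ∧ a.val ≤ t + l then (-1 : ℂ) ^ (t + a.val + b.val) * ((Nat.choose l t * Nat.choose l (t + b.val - l) * Nat.choose l (t + l - a.val) : ℕ) : ℂ) else 0) else 0; ∀ l : ℕ, 2 ≤ l → Literature.Computability.AlgebraicComplexity.asymptoticRank (J l) = 2 * (l : ℝ) + 1) :
    Summit.MatrixMultiplication.MatrixMultiplication.Theses.NonabelianARC.NAARCLadder := by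
  -- `ω(ℂ) = 2` from `Det3Flat` by the landed glue of route AsymptoticRankCW (same item, verbatim)
  have hω : omega ℂ = 2 :=
    MatrixMultiplication_iff.1
      ((show Summit.MatrixMultiplication.MatrixMultiplication.Theses.AsymptoticRankCW.BDet3AsymptoticRank →
          _root_.MatrixMultiplication from glueDet3Omega_proof) h₁)
  have h3 := asymptoticRank_leviCivita_eq_three_of_det3 h₁
  unfold Summit.MatrixMultiplication.MatrixMultiplication.Theses.NonabelianARC.NAARCLadder
  intro J
  refine ⟨fun n hn => ?_, fun l hl => ?_⟩
  · rw [asymptoticRank_matMulTensor ℂ n hn, hω, Real.rpow_two]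
  · rcases Nat.lt_or_ge l 2 with hlt | hge
    · obtain rfl : l = 1 := by omega
      show asymptoticRank (threeJTensor 1) = 2 * ((1 : ℕ) : ℝ) + 1
      rw [asymptoticRank_threeJTensor_one, h3]
      norm_num
    · exact h₂ l hge

/-- **The route's glue item `NAARCLadderOfRungs`** (`stmt-MatrixMultiplication-17871`,
`Det3Flat → JLadderHigherFlat → NAARCLadder`), closed by `NAARCLadder_of_subs`: the two route decls
unfold to the inlined hypotheses verbatim. A prover landing this file closes the item with
`ledger workitem close stmt-MatrixMultiplication-17871 --as proved --by <this decl>`.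
[cite: ConnerGesmundoLandsbergVentura2022, §2.2–2.3] -/
theorem naarcLadderOfRungs_proof :
    Summit.MatrixMultiplication.MatrixMultiplication.Theses.NonabelianARC.NAARCLadderOfRungs :=
  fun h₁ h₂ => NAARCLadder_of_subs h₁ h₂

end Split

end Summit.MatrixMultiplication.MatrixMultiplication.Theorems

end
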